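import Mathlib
import Summits.Ventures.PercRepro2.HalfLTwoMarkBlocks
import Summits.Ventures.PercRepro2.HalfEndpointIdentity
import Summits.Ventures.PercRepro2.HalfL

/-!
# HALF-L, HALF-H and (HCOV) for `a₃` adjacent exactly to `o` and `b` (blind cell PercRepro2, night-1 g37)

`GammaLc_twoMark`: for `a₃ ~ {o, b}` (`CaseOne.IsTwoMarkAt`), `ΓLc = 2 · lhs (p eo) (p eb) (cells)` — the
endpoint identity `HalfEndpoint.GammaLc_eq_endpoint` with the ten masses of `HalfLTwoMarkMasses`
substituted; hence **`HalfL_twoMark`** (the cells and the blocks are nonnegative, `lhs_nonneg`),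
**`HalfH_twoMark`** (the root swap) and **`HCov_twoMark`**: (HCOV) holds on the whole degree-2 class
`N(a₃) = {o, b}`, every weight `r₁ = p(o a₃)`, `r₂ = p(b a₃)`, every base graph — the class of the SHARP-L
witness family, closed by the certified Bernstein form of `D · HALF-L`.
-/

namespace Summit.Ventures.PercRepro2

namespace HalfLTwoMark

open CaseOne CovForm SharpHalves UnionCluster

section Main

variable {V : Type*} {E : Type*} [Fintype E] [DecidableEq E] [Fintype V] [DecidableEq V]
  {R : Type*} [Field R] [LinearOrder R] [IsStrictOrderedRing R]
variable {ends : E → Sym2 V} {o b a₃ : V} {eo eb : E}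

omit [Fintype E] [DecidableEq E] [Fintype V] [DecidableEq V] in
/-- `avoidAll a₂ {a₁} = (connEvent a₁ a₂)ᶜ`. -/
lemma avoidAll_eq_Q (ends : E → Sym2 V) (a₁ a₂ : V) :
    avoidAll ends a₂ {a₁} = (connEvent ends a₁ a₂)ᶜ := by
  ext ω
  simp only [mem_avoidAll, Finset.mem_singleton, forall_eq, Set.mem_compl_iff, mem_connEvent]
  exact ⟨fun hh hc => hh (conn_symm hc), fun hh hc => hh (conn_symm hc)⟩

omit [Fintype E] [DecidableEq E] [Fintype V] [DecidableEq V] in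
/-- `TEvent a₁ a₂ a₃ = (connEvent a₁ a₂)ᶜ ∩ connEvent a₂ a₃`. -/
lemma TEvent_eq (ends : E → Sym2 V) (a₁ a₂ a₃ : V) :
    TEvent ends a₁ a₂ a₃ = (connEvent ends a₁ a₂)ᶜ ∩ connEvent ends a₂ a₃ := by
  unfold TEvent
  rw [connEvent_comm ends a₂ a₁]

omit [Fintype E] [DecidableEq E] [Fintype V] [DecidableEq V] in
/-- `Dtilde a₁ a₂ o = (connEvent a₁ o ∪ connEvent a₂ o)ᶜ`. -/
lemma Dtilde_eq (ends : E → Sym2 V) (o a₁ a₂ : V) :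
    Dtilde ends a₁ a₂ o = (connEvent ends a₁ o ∪ connEvent ends a₂ o)ᶜ := by
  unfold Dtilde UnionCluster.inU
  rw [connEvent_comm ends o a₁, connEvent_comm ends o a₂]

omit [Fintype V] [DecidableEq V] [LinearOrder R] [IsStrictOrderedRing R] in
/-- `D_o = P(PD ∩ {o ∈ U})`. -/
lemma Do_eq (p : E → R) (ends : E → Sym2 V) (o a₁ a₂ a₃ : V) :
    Do p ends o a₁ a₂ a₃ =
      prob p (PDEvent ends a₁ a₂ a₃ ∩ (connEvent ends a₁ o ∪ connEvent ends a₂ o)) := by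
  unfold Do
  rw [Set.inter_union_distrib_left, prob_union_of_disjoint p]
  exact Set.disjoint_left.2 fun ω h1 h2 => h1.1.1 (conn_trans h1.2 (conn_symm h2.2))

omit [Fintype V] in
/-- **`ΓLc` for `a₃ ~ {o, b}`**: `ΓLc = 2 · lhs r₁ r₂ (cells)`. -/
theorem GammaLc_twoMark (p : E → R) (h : IsTwoMarkAt ends o b a₃ eo eb) {a₁ a₂ : V}
    (h1 : a₁ ≠ a₃) (h2 : a₂ ≠ a₃) :
    GammaLc p ends o a₁ a₂ a₃ b = 2 * lhs (p eo) (p eb) (cellsOf p ends o a₁ a₂ b eo eb) := by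
  rw [HalfEndpoint.GammaLc_eq_endpoint p ends o a₁ a₂ a₃ b, Do_eq, avoidAll_eq_Q, TEvent_eq,
    Dtilde_eq]
  have ePD : PDEvent ends a₁ a₂ a₃ =
      (connEvent ends a₁ a₂)ᶜ ∩ (connEvent ends a₃ a₁ ∪ connEvent ends a₃ a₂)ᶜ := rfl
  rw [ePD]
  -- the complement masses
  have cT := prob_inter_add_prob_inter_compl p ((connEvent ends a₁ a₂)ᶜ ∩ connEvent ends a₂ a₃)
    (connEvent ends a₁ o ∪ connEvent ends a₂ o)
  have cTb := prob_inter_add_prob_inter_compl p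
    ((connEvent ends a₁ a₂)ᶜ ∩ connEvent ends a₂ a₃ ∩ connEvent ends a₁ b)
    (connEvent ends a₁ o ∪ connEvent ends a₂ o)
  have eTb : (connEvent ends a₁ a₂)ᶜ ∩ connEvent ends a₂ a₃ ∩
      (connEvent ends a₁ b ∩ (connEvent ends a₁ o ∪ connEvent ends a₂ o)ᶜ) =
      (connEvent ends a₁ a₂)ᶜ ∩ connEvent ends a₂ a₃ ∩ connEvent ends a₁ b ∩
        (connEvent ends a₁ o ∪ connEvent ends a₂ o)ᶜ := (Set.inter_assoc _ _ _).symm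
  have ebLoH : (connEvent ends a₁ a₂)ᶜ ∩ (connEvent ends a₂ o ∩ connEvent ends a₁ b) =
      (connEvent ends a₁ a₂)ᶜ ∩ connEvent ends a₂ o ∩ connEvent ends a₁ b := (Set.inter_assoc _ _ _).symm
  rw [eTb, ebLoH]
  rw [mass_Q p h h1 h2, mass_bL p h h1 h2, mass_T p h h1 h2, mass_TbL p h h1 h2,
    mass_TbLoU p h h1 h2, mass_oH p h h1 h2, mass_bLoH p h h1 h2, mass_ToU p h h1 h2,
    mass_PD p h h1 h2, mass_PDoU p h h1 h2] at *
  unfold lhs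
  linear_combination (2 * mPD (p eo) (p eb) (cellsOf p ends o a₁ a₂ b eo eb) *
      mbL (p eo) (p eb) (cellsOf p ends o a₁ a₂ b eo eb)) * cT -
    (2 * mPD (p eo) (p eb) (cellsOf p ends o a₁ a₂ b eo eb) *
      mQ (p eo) (p eb) (cellsOf p ends o a₁ a₂ b eo eb)) * cTb

/-- **HALF-L on the class `a₃ ~ {o, b}`**, every weight. -/
theorem HalfL_twoMark (p : E → R) (hp : IsProbVec p) (h : IsTwoMarkAt ends o b a₃ eo eb) {a₁ a₂ : V}
    (h1 : a₁ ≠ a₃) (h2 : a₂ ≠ a₃) : HalfL p ends o a₁ a₂ a₃ b := by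
  unfold HalfL
  rw [GammaLc_twoMark p h h1 h2]
  have := lhs_nonneg (p eo) (p eb) (cellsOf p ends o a₁ a₂ b eo eb)
    (cellsNonneg p hp ends o a₁ a₂ b eo eb) (blocksNonneg p hp ends o a₁ a₂ b eo eb)
    (hp.nonneg eo) (hp.le_one eo) (hp.nonneg eb) (hp.le_one eb)
  linarith

/-- **HALF-H on the class `a₃ ~ {o, b}`** (the root swap of `HalfL_twoMark`). -/
theorem HalfH_twoMark (p : E → R) (hp : IsProbVec p) (h : IsTwoMarkAt ends o b a₃ eo eb) {a₁ a₂ : V}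
    (h1 : a₁ ≠ a₃) (h2 : a₂ ≠ a₃) : HalfH p ends o a₁ a₂ a₃ b :=
  (HalfH_iff p ends o a₁ a₂ a₃ b).2 (HalfL_twoMark p hp h h2 h1)

/-- **(HCOV) on the class `a₃ ~ {o, b}`**: `a₃` adjacent exactly to `o` and `b`, every weight, every base graph. -/
theorem HCov_twoMark (p : E → R) (hp : IsProbVec p) (h : IsTwoMarkAt ends o b a₃ eo eb) {a₁ a₂ : V}
    (h1 : a₁ ≠ a₃) (h2 : a₂ ≠ a₃) : HCov p ends o a₁ a₂ a₃ b :=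
  HCov_of_HalfL_HalfH p ends o a₁ a₂ a₃ b (HalfL_twoMark p hp h h1 h2) (HalfH_twoMark p hp h h1 h2)

end Main

end HalfLTwoMark

end Summit.Ventures.PercRepro2
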